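import Summits.QuantumFields.BalabanUV.Beta.GAN24.CubicPushGaugeLegUnfolding
import Summits.QuantumFields.BalabanUV.Beta.GAN24.GaugeLegDefectsBlockConstant
import Summits.QuantumFields.BalabanUV.Beta.GAN24.BorderGaugeLegBlockPotential

/-!
# `BalabanUV.Beta.GAN24.BorderSectorSourcePairingSucc` — binder row G-an2-4 ∕ (CONV-C), the (S) row ∕ (W-γ) one level up, (ζ-V):
# **THE BORDER SECTOR OF `X_{j+1}` IN CLOSED FORM** — every `j`, in-block root, every slot `(l, t)`, bounded `n`, bounded coarse potential `φ`:
# `Σ'_{(u,x)} Σ_κ Σ_κ₂ n κ u·(dz φ) κ₂ x·e3OfK Lc G_j (vhSAt ρ) l t u x (inl κ)(inl κ₂)`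
# `= cH_j·(Lc^{d+1})⁻¹·Σ'_{y₀} Σ_μ (Σ_κ Σ'_u n κ u·colM G_j Lc μ y₀ κ u)·(dz φ) μ y₀·EI_{Lc}(colH G_j Lc l t) μ y₀`   (`cH_j = (stepScale_j·Lc^{d+1})⁻¹`)
# (G-an2-4 CRUX TEAM (2), seat `b2b-balaban-gan24-formalise-leaf-02` = SUPPLIER side of leaf-06's (C2′)∕`hX` mechanism, gen 61; INTENT [LEAF02-G61-INTENT1], PART 2 of 2)

NOT IN PRINT; OUR BOOKKEEPING ([folklore] Fubini bookkeeping BY NAME over PART 1 `CubicPushGaugeLegUnfolding.hasSum_prod_gaugeLeg_e3OfK` (the three-leg unfolding), leaf-02 g47's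
fluctuation-slot law of an1's border table `BorderGaugeLegContact.tsum_vhSAt_mul_dz` (through (β)), leaf-06 g49's (β) `GaugeLegDefectsBlockConstant.border_gaugeLeg_blockConstant`,
leaf-02 g60's `BorderGaugeLegBlockPotential.colH_coDressKBmAt_eq_zero_of_isCombBond`, an1's `locStencil_vhSAt` and an4's `vertexFamily_vertexOfK`; 0 `def`, 0 cited fact,
0 `def … : Prop`, 0 sorry).
HONEST FRAMING (cell contract, verbatim): «discharging `BetaPertH` makes Bałaban's UV stability UNCONDITIONAL — a real constructive-QFT result; it is NOT the continuum limit and NOT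
the Clay problem.»  HONEST DEPENDENCY (verbatim): «continuum YM on T⁴ ⇐ BetaPertH ∧ nine spine estimates (0/9 proved); BetaPertH ⇐ (D1) ∧ (D4) ∧ CAP+tail; G-an2-4 gates asym,
D1 and NE2/3/4.»

WHY (leaf-06 g49 R1 ∕ ENGINE E31, memo `HOME/b2b-balaban-gan24-formalise-leaf-06/g49/E30-E31-CENSUS.md` §(B): «V = −n^{−2D}·(C1′)», exact for generic `h, n`, D = 2, 3).  The border
sector of `SrecAt j` is `(cVH·wVH_j)•vhSAt ρ` (`SrecAt_succ`; at `j = 0` the `cVH`-summand of `S0NAt`); inside `X_{j+1}` it is dressed by two `G_j`-legs.  PART 1 unfolds them: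
the gauge leg `dφ` lands on the field legs of the border vertex as the block pure gauge `cH_j·d(φ∘blk)`; the border table has no field–field block, so the `n`-leg enters only through
its MULTIPLIER rows, i.e. through the multiplier response `Σ_κ Σ'_u n κ u·colM G_j Lc μ y₀ κ u` at the coarse points `y = Lc•y₀` (off them the multiplier leg of `vhSAt` is empty);
what is left at each `(μ, y₀)` is exactly (β)'s pairing of `vhSAt` with the block pure gauge on the fluctuation leg and the comb-free background form `g := colH G_j Lc l t`, whose
value is `−(Lc^{d+1})⁻¹·(dz φ) μ y₀·EI_{Lc} g μ y₀` — the END-INSIDE partial contour sum of the response column.  (The Λ- and E-sector unfoldings run through the same PART 1 with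
`S = SLam … hessFFAt` resp. the cubic member; they and the pin assembly (η) ⇒ `hX` are NOT here.)
* §1 `vertexOfK_vhSAt_inl_inl ∕ _inr_inl_of_off` (block structure of the border vertex), **`tsum_sum_vertexOfK_vhSAt_mul_dz`** (the border vertex at a coarse multiplier point against
  the block pure gauge IS (β)'s pairing with `g := colH G_j Lc l t`: unfold `Σ_κ′ Σ'_{u′} colH·vhSAt κ′ u′`, exchange the two series — the stencil is localised in both legs — and read (β)).
* §2 **`hasSum_prod_gaugeLeg_e3OfK_vhSAt`** — THE BORDER SECTOR ONE LEVEL UP IN CLOSED FORM (statement in the title).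
Asserts NO value of any resolvent column beyond the Ward laws quoted; NOTHING of (C2′) ∕ (W-γ) at levels ≥ 1 ∕ (INV) ∕ (S) discharged; NEVER «G-an2-4 closed» as (CONV-C); NOT D1,
NOT `BetaPertH`, NOT continuum, NOT Clay.  2026-08-23; no existing file touched.
-/

noncomputable section

open Finset
open scoped BigOperators
open Literature.MathematicalPhysics.QuantumFieldTheory
open Literature.MathematicalPhysics.QuantumFieldTheory.Balaban1983to89
open Literature.MathematicalPhysics.QuantumFieldTheory.Balaban1983to89.Beta
open Literature.Probability.LatticeModels (Torus.proj)
open LatticeForm (quo)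
open B12Sec2to5 (l1 l1_nonneg)
open ExpKernelCalculus (Site MKer BiLoc Decays comp Zl Zl_nonneg summable_exp_shift summable_exp_shift' l1_sub_symm)
open OneStepResolventKernel (Fib LocStencil eq_zsmul_quo_of_proj)
open AffineAveraging (Form0 Form1 box toSite unitVec unitVec_apply dz contourSum)
open AveragingContours (blk blk_block off blk_add_off)
open AxialProjector (blk_zsmul)
open RootedKernelReflection (off_zsmul)
open OneStepKernelFamily (KInvStep colH vertexOfK vertexFamily_vertexOfK decays_KInvStep KInvStep_inr_off)
open SecondOrderResponse (colM)
open BalabanStepJetsSucc (mmRead mmRead_inl_inl)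
open BalabanStepJets (locStencil_mono)
open AveragingHessianKernels (packVH_inr_inl packVH_inl_inl)
open AveragingHessianKernelsRooted (vhSAt locStencil_vhSAt)
open AveragingWardStencils (b6UnitVec_eq)
open Summit.QuantumFields.BalabanUV.Beta.AxialDressingRooted (IsCombBondAt coDressKBmAt coDressKBmAt_inr_inr decays_coDressKBmAt one_le_of_neZero)
open Summit.QuantumFields.BalabanUV.Beta.BorderedHessian (stepScale)
open Summit.QuantumFields.BalabanUV.Beta.SpineRooted (e3OfK e3OfK_apply)
open Summit.QuantumFields.BalabanUV.Beta.AveragingWardRootedStencils (linSymAt linSymAt_inr_inl)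
open Summit.QuantumFields.BalabanUV.Beta.GAN24.KernelLegCharges (summable_prod_of_biLoc summable_exp_coarse)
open Summit.QuantumFields.BalabanUV.Beta.GAN24.ResolventLegCharges (summable_exp_coarse' tsum_exp_coarse_le tsum_exp_coarse_le')
open Summit.QuantumFields.BalabanUV.Beta.GAN24.CoarseGaugeSourceResponse (summable_bdd_mul sum_tsum_coarseGrad_colH sum_tsum_coarseGrad_colM)
open Summit.QuantumFields.BalabanUV.Beta.GAN24.ChargeTowerLegs (hasSum_sandwich_readout_two)
open Summit.QuantumFields.BalabanUV.Beta.GAN24.ChargeTowerStep (comp_comp_weighted)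
open Summit.QuantumFields.BalabanUV.Beta.GAN24.CubicPushFaceCharge (vhSAt_inl_inl)
open Summit.QuantumFields.BalabanUV.Beta.GAN24.BorderGaugeLegContact (tsum_vhSAt_mul_dz)
open Summit.QuantumFields.BalabanUV.Beta.GAN24.GaugeLegDefectsBlockConstant (border_gaugeLeg_blockConstant)
open Summit.QuantumFields.BalabanUV.Beta.GAN24.BorderGaugeLegBlockPotential (colH_coDressKBmAt_eq_zero_of_isCombBond)

open Summit.QuantumFields.BalabanUV.Beta.GAN24.CubicPushGaugeLegUnfolding (tsum_eq_tsum_zsmul_of_off summable_weight_row hasSum_prod_gaugeLeg_e3OfK)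

namespace Summit.QuantumFields.BalabanUV.Beta.GAN24.BorderSectorSourcePairingSucc

variable {d : ℕ}

/-! ## §1 The border vertex: block structure and the pairing with a block pure gauge -/

section Step

variable {Lc : ℕ} [NeZero Lc] {r : Fin (d + 1) → ℕ}


/-- [folklore] The border vertex has no field–field block (`vhSAt_inl_inl`). -/
theorem vertexOfK_vhSAt_inl_inl (K : MKer (d + 1) (Fib d)) (L : ℕ) (ρ : Fin (d + 1) → ℤ) (l : Fin (d + 1)) (t y w : Site (d + 1)) (a b : Fin (d + 1)) :
    vertexOfK K L (fun κ' u' => vhSAt ρ d L rfl κ' u') l t y w (Sum.inl a) (Sum.inl b) = 0 := by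
  simp only [vertexOfK, OneStepResolventKernel.wsum, vhSAt_inl_inl, mul_zero, tsum_zero, Finset.sum_const_zero]

/-- [folklore] The multiplier leg of the border vertex lives on the coarse images: off them the `(inr, inl)` block vanishes. -/
theorem vertexOfK_vhSAt_inr_inl_of_off (K : MKer (d + 1) (Fib d)) (L : ℕ) (ρ : Fin (d + 1) → ℤ) (l : Fin (d + 1)) (t : Site (d + 1)) {y : Site (d + 1)}
    (hy : off L y ≠ 0) (w : Site (d + 1)) (m a : Fin (d + 1)) :
    vertexOfK K L (fun κ' u' => vhSAt ρ d L rfl κ' u') l t y w (Sum.inr m) (Sum.inl a) = 0 := by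
  simp only [vertexOfK, OneStepResolventKernel.wsum, vhSAt, packVH_inr_inl, if_neg hy, mul_zero, tsum_zero, Finset.sum_const_zero]

/-- NOT IN PRINT; OUR BOOKKEEPING.  **THE BORDER VERTEX AGAINST A BLOCK PURE GAUGE IS (β)'s PAIRING** (in-block root, `1 ≤ Lc`, every `j l t`, coarse label `y₀`, slot `m`, bounded
`φ`): `Σ'_w Σ_a (vertexOfK G_j Lc (vhSAt ρ) l t) (Lc•y₀) w (inr m)(inl a)·dz(φ∘blk) a w = −(Lc^{d+1})⁻¹·(dz φ m y₀·EI_{Lc}(colH G_j Lc l t) m y₀)` — unfold the vertex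
(`Σ_κ′ Σ'_{u′} colH·vhSAt κ′ u′`), exchange the two series (the stencil is localised in both legs), and read (β) `border_gaugeLeg_blockConstant` at `g := colH G_j Lc l t` (comb-free). -/
theorem tsum_sum_vertexOfK_vhSAt_mul_dz (hr : r ∈ box (d + 1) Lc) (j : ℕ) (l : Fin (d + 1)) (t : Site (d + 1)) (y₀ : Site (d + 1)) (m : Fin (d + 1))
    {φ : Site (d + 1) → ℝ} {Bφ : ℝ} (hφ : ∀ y, |φ y| ≤ Bφ) :
    ∑' w : Site (d + 1), ∑ a : Fin (d + 1),
        vertexOfK (coDressKBmAt (toSite r) Lc (KInvStep (d := d) Lc j)) Lc (fun κ' u' => vhSAt (toSite r) d Lc rfl κ' u') l t ((Lc : ℤ) • y₀) w (Sum.inr m) (Sum.inl a)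
          * dz (fun x => φ (blk Lc x)) a w
      = -(((Lc : ℝ) ^ (d + 1))⁻¹ * (dz φ m y₀
          * ∑ b ∈ box (d + 1) Lc, ∑ s ∈ Finset.range Lc, (if b m + s + 1 < Lc then
              colH (coDressKBmAt (toSite r) Lc (KInvStep (d := d) Lc j)) Lc l t m ((Lc : ℤ) • y₀ + toSite b + (s : ℤ) • unitVec m) else 0))) := by
  classical
  have hLc : 1 ≤ Lc := one_le_of_neZero Lc
  set G : MKer (d + 1) (Fib d) := coDressKBmAt (toSite r) Lc (KInvStep (d := d) Lc j) with hGdef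
  set y : Site (d + 1) := (Lc : ℤ) • y₀ with hydef
  obtain ⟨δ, C, hδ, -, hK⟩ := decays_KInvStep (d := d) (Lc := Lc) j
  obtain ⟨δG, CG, hδG, hCG, hG⟩ := decays_coDressKBmAt hLc hr (K := KInvStep (d := d) Lc j) ⟨δ, C, hδ, hK.nonneg (Sum.inl 0), hK⟩
  have hSt := locStencil_vhSAt (d := d) hLc hr (δ := 1) zero_le_one
  set Cs : ℝ := 3 * (AveragingHessianKernels.ell (d + 1) Lc : ℝ) ^ 2 * Real.exp (4 * ((d : ℝ) + 1) * Lc * 1) with hCs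
  have hCs0 : 0 ≤ Cs := (hSt 0 0).nonneg (Sum.inl 0)
  have hBφ : 0 ≤ Bφ := (abs_nonneg _).trans (hφ 0)
  have hg : ∀ a w, |dz (fun x => φ (blk Lc x)) a w| ≤ 2 * Bφ := KKTFluctuationEnergy.abs_dz_le (fun x => hφ (blk Lc x))
  have hcol : ∀ κ' u', |colH G Lc l t κ' u'| ≤ CG := fun κ' u' => by
    refine (hG _ _ _ _).trans ?_
    have h1 : Real.exp (-δG * l1 (u' - (Lc : ℤ) • t)) ≤ 1 := Real.exp_le_one_iff.2 (by
      have := l1_nonneg (u' - (Lc : ℤ) • t); nlinarith)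
    exact (mul_le_mul_of_nonneg_left h1 hCG).trans (le_of_eq (mul_one _))
  -- the exchange family `(u′, w)`
  set F : Site (d + 1) → Site (d + 1) → ℝ := fun u' w => ∑ κ', ∑ a : Fin (d + 1),
    colH G Lc l t κ' u' * (vhSAt (toSite r) d Lc rfl κ' u' y w (Sum.inr m) (Sum.inl a) * dz (fun x => φ (blk Lc x)) a w) with hF
  set M : Site (d + 1) → Site (d + 1) → ℝ := fun u' w =>
    (((d + 1 : ℕ) : ℝ) * ((d + 1 : ℕ) : ℝ) * (CG * Cs * (2 * Bφ))) * (Real.exp (-1 * l1 (y - u')) * Real.exp (-1 * l1 (w - u'))) with hM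
  have hterm : ∀ (κ' a : Fin (d + 1)) (u' w : Site (d + 1)),
      |colH G Lc l t κ' u' * (vhSAt (toSite r) d Lc rfl κ' u' y w (Sum.inr m) (Sum.inl a) * dz (fun x => φ (blk Lc x)) a w)|
        ≤ (CG * Cs * (2 * Bφ)) * (Real.exp (-1 * l1 (y - u')) * Real.exp (-1 * l1 (w - u'))) := by
    intro κ' a u' w
    rw [abs_mul, abs_mul]
    have e1 := hcol κ' u'
    have e2 : |vhSAt (toSite r) d Lc rfl κ' u' y w (Sum.inr m) (Sum.inl a)| ≤ Cs * Real.exp (-1 * (l1 (y - u') + l1 (w - u'))) := hSt κ' u' y w _ _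
    rw [mul_add, Real.exp_add] at e2
    have e3 := hg a w
    calc |colH G Lc l t κ' u'| * (|vhSAt (toSite r) d Lc rfl κ' u' y w (Sum.inr m) (Sum.inl a)| * |dz (fun x => φ (blk Lc x)) a w|)
        ≤ CG * ((Cs * (Real.exp (-1 * l1 (y - u')) * Real.exp (-1 * l1 (w - u')))) * (2 * Bφ)) :=
          mul_le_mul e1 (mul_le_mul e2 e3 (abs_nonneg _) (by positivity)) (by positivity) hCG
      _ = _ := by ring
  have hFM : ∀ u' w, |F u' w| ≤ M u' w := by
    intro u' w
    simp only [hF, hM]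
    refine (Finset.abs_sum_le_sum_abs _ _).trans ?_
    calc ∑ κ', |∑ a : Fin (d + 1), colH G Lc l t κ' u' * (vhSAt (toSite r) d Lc rfl κ' u' y w (Sum.inr m) (Sum.inl a) * dz (fun x => φ (blk Lc x)) a w)|
        ≤ ∑ κ' : Fin (d + 1), ∑ a : Fin (d + 1), (CG * Cs * (2 * Bφ)) * (Real.exp (-1 * l1 (y - u')) * Real.exp (-1 * l1 (w - u'))) :=
          Finset.sum_le_sum fun κ' _ => (Finset.abs_sum_le_sum_abs _ _).trans (Finset.sum_le_sum fun a _ => hterm κ' a u' w)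
      _ = _ := by simp only [Finset.sum_const, Finset.card_univ, Fintype.card_fin, nsmul_eq_mul]; ring
  have hM0 : ∀ u' w, 0 ≤ M u' w := fun u' w => by positivity
  have hMin : ∀ u', HasSum (fun w => M u' w)
      ((((d + 1 : ℕ) : ℝ) * ((d + 1 : ℕ) : ℝ) * (CG * Cs * (2 * Bφ))) * (Real.exp (-1 * l1 (y - u')) * Zl (d + 1) 1)) := by
    intro u'
    have h1 := (summable_exp_shift' (D := d + 1) one_pos u').hasSum
    rw [ExpKernelCalculus.tsum_exp_shift' (c := (1 : ℝ)) u'] at h1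
    exact (h1.mul_left _).mul_left _
  have hMs : Summable (Function.uncurry M) := by
    refine (summable_prod_of_nonneg (fun s => hM0 s.1 s.2)).2 ⟨fun u' => (hMin u').summable, ?_⟩
    have e : (fun u' => ∑' w, M u' w) = fun u' => ((((d + 1 : ℕ) : ℝ) * ((d + 1 : ℕ) : ℝ) * (CG * Cs * (2 * Bφ))) * Zl (d + 1) 1) * Real.exp (-1 * l1 (u' - y)) := by
      funext u'; rw [(hMin u').tsum_eq, l1_sub_symm]; ring
    rw [e]
    exact (summable_exp_shift' one_pos y).mul_left _
  have hFs : Summable (Function.uncurry F) :=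
    Summable.of_norm_bounded hMs (fun s => by rw [Real.norm_eq_abs]; exact hFM s.1 s.2)
  -- per-leg summabilities
  have hsu : ∀ (κ' a : Fin (d + 1)) (w : Site (d + 1)), Summable fun u' : Site (d + 1) =>
      colH G Lc l t κ' u' * (vhSAt (toSite r) d Lc rfl κ' u' y w (Sum.inr m) (Sum.inl a) * dz (fun x => φ (blk Lc x)) a w) := by
    intro κ' a w
    have hmaj : Summable fun u' : Site (d + 1) => (CG * Cs * (2 * Bφ)) * (Real.exp (-1 * l1 (y - u')) * Real.exp (-1 * l1 (w - u'))) := by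
      have h1 : Summable fun u' : Site (d + 1) => (CG * Cs * (2 * Bφ)) * Real.exp (-1 * l1 (u' - y)) := (summable_exp_shift' one_pos y).mul_left _
      refine Summable.of_nonneg_of_le (fun u' => by positivity) (fun u' => ?_) h1
      rw [l1_sub_symm y u']
      have h2 : Real.exp (-1 * l1 (w - u')) ≤ 1 := Real.exp_le_one_iff.2 (by have := l1_nonneg (w - u'); nlinarith)
      calc (CG * Cs * (2 * Bφ)) * (Real.exp (-1 * l1 (u' - y)) * Real.exp (-1 * l1 (w - u')))
          ≤ (CG * Cs * (2 * Bφ)) * (Real.exp (-1 * l1 (u' - y)) * 1) :=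
            mul_le_mul_of_nonneg_left (mul_le_mul_of_nonneg_left h2 (Real.exp_pos _).le) (by positivity)
        _ = _ := by ring
    exact Summable.of_norm_bounded hmaj (fun u' => by rw [Real.norm_eq_abs]; exact hterm κ' a u' w)
  have hsw : ∀ (κ' a : Fin (d + 1)) (u' : Site (d + 1)), Summable fun w : Site (d + 1) =>
      colH G Lc l t κ' u' * (vhSAt (toSite r) d Lc rfl κ' u' y w (Sum.inr m) (Sum.inl a) * dz (fun x => φ (blk Lc x)) a w) := by
    intro κ' a u'
    have hmaj : Summable fun w : Site (d + 1) => (CG * Cs * (2 * Bφ)) * (Real.exp (-1 * l1 (y - u')) * Real.exp (-1 * l1 (w - u'))) :=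
      ((summable_exp_shift' one_pos u').mul_left ((CG * Cs * (2 * Bφ)) * Real.exp (-1 * l1 (y - u')))).congr fun w => by ring
    exact Summable.of_norm_bounded hmaj (fun w => by rw [Real.norm_eq_abs]; exact hterm κ' a u' w)
  -- LHS = Σ'_w Σ'_{u′} F u′ w
  have hL : (∑' w : Site (d + 1), ∑ a : Fin (d + 1),
      vertexOfK G Lc (fun κ' u' => vhSAt (toSite r) d Lc rfl κ' u') l t y w (Sum.inr m) (Sum.inl a) * dz (fun x => φ (blk Lc x)) a w)
      = ∑' w : Site (d + 1), ∑' u' : Site (d + 1), F u' w := by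
    refine tsum_congr fun w => ?_
    have rhs : (∑' u' : Site (d + 1), F u' w) = ∑ κ', ∑ a : Fin (d + 1), ∑' u' : Site (d + 1),
        colH G Lc l t κ' u' * (vhSAt (toSite r) d Lc rfl κ' u' y w (Sum.inr m) (Sum.inl a) * dz (fun x => φ (blk Lc x)) a w) := by
      simp only [hF]
      rw [Summable.tsum_finsetSum (fun κ' _ => summable_sum fun a _ => hsu κ' a w)]
      exact Finset.sum_congr rfl fun κ' _ => Summable.tsum_finsetSum (fun a _ => hsu κ' a w)
    rw [rhs]
    conv_rhs => rw [Finset.sum_comm]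
    simp only [vertexOfK, OneStepResolventKernel.wsum]
    refine Finset.sum_congr rfl fun a _ => ?_
    rw [Finset.sum_mul]
    refine Finset.sum_congr rfl fun κ' _ => ?_
    rw [← tsum_mul_right]
    exact tsum_congr fun u' => by ring
  -- RHS side: Σ'_{u′} Σ'_w F u′ w = (β)'s pairing
  have hR : (∑' u' : Site (d + 1), ∑' w : Site (d + 1), F u' w)
      = ∑' u' : Site (d + 1), ∑ κ', colH G Lc l t κ' u' *
          (∑' w : Site (d + 1), ∑ a : Fin (d + 1), vhSAt (toSite r) d Lc rfl κ' u' y w (Sum.inr m) (Sum.inl a) * dz (fun x => φ (blk Lc x)) a w) := by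
    refine tsum_congr fun u' => ?_
    simp only [hF]
    rw [Summable.tsum_finsetSum (fun κ' _ => summable_sum fun a _ => hsw κ' a u')]
    refine Finset.sum_congr rfl fun κ' _ => ?_
    rw [← tsum_mul_left]
    refine tsum_congr fun w => ?_
    rw [Finset.mul_sum]
  have hg0 : ∀ κ u, IsCombBondAt (toSite r) Lc κ u → (fun κ' u' => colH G Lc l t κ' u') κ u = 0 :=
    fun κ u hc => colH_coDressKBmAt_eq_zero_of_isCombBond (toSite r) (KInvStep (d := d) Lc j) l t hc
  rw [hL, hFs.tsum_comm, hR]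
  have hβ := border_gaugeLeg_blockConstant (d := d) hLc hr hg0 m y₀ φ
  simpa only [hydef, hGdef] using hβ

/-! ## §2 The border sector of the source pairing one level up -/

/-- NOT IN PRINT; OUR BOOKKEEPING.  **THE BORDER SECTOR OF THE SOURCE PAIRING ONE LEVEL UP, CLOSED FORM** (every `j`, in-block root `ρ = toSite r`, every slot `(l, t)`, bounded `n`,
bounded coarse potential `φ`; `G_j = coDressKBmAt ρ Lc (KInvStep Lc j)`, `cH_j = (stepScale_j·Lc^{d+1})⁻¹`):
`HasSum ((u,x) ↦ Σ_κ Σ_κ₂ n κ u·(dz φ) κ₂ x·e3OfK Lc G_j (vhSAt ρ) l t u x (inl κ)(inl κ₂))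
   (cH_j·(Lc^{d+1})⁻¹·Σ'_{y₀} Σ_μ (Σ_κ Σ'_u n κ u·colM G_j Lc μ y₀ κ u)·((dz φ) μ y₀·EI_{Lc}(colH G_j Lc l t) μ y₀))`,
`EI_{Lc} v μ y₀ = Σ_{b∈box} Σ_{s<Lc} [b_μ+s+1 < Lc]·v μ (Lc•y₀ + b + s•e_μ)` — ENGINE E31's «V = −n^{−2D}·(C1′)» as a theorem: the border table of `S_j` dressed by the two `G_j`-legs
sees the block pure gauge only through the END-INSIDE partial contour sum of the response column in the slot, weighted by the multiplier response of `n`.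
USAGE.  `φ` is any BOUNDED coarse potential: road-P2 g44's `hX` label `φ := fun z => if blk Lc z = y then 1 else 0` qualifies with `Bφ = 1` (so does every finitely supported `φ`);
`n` any bounded 1-form (`n⋆` qualifies).  The `n`-leg weight is leaf-06's `C`-currency: `colM G_j Lc μ y₀ κ u = wΦ_{Lc^{j+1}} κ μ (u − y₀)` (`KernelWardMColumn.colM_coDressKBmAt` ⨾
`MultiplierZeroMass.colM_KInvStep`); the slot sum `Σ_l Σ'_t h l t·(…)` turns `EI_{Lc}(colH G_j Lc l t)` into `EI_{Lc}(H_j h)` by linearity ((β) with `g := H_j h`). -/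
theorem hasSum_prod_gaugeLeg_e3OfK_vhSAt (hr : r ∈ box (d + 1) Lc) (j : ℕ) (l : Fin (d + 1)) (t : Site (d + 1))
    {n : Form1 (d + 1) ℝ} {Bn : ℝ} (hn : ∀ κ u, |n κ u| ≤ Bn) {φ : Site (d + 1) → ℝ} {Bφ : ℝ} (hφ : ∀ y, |φ y| ≤ Bφ) :
    HasSum (fun ux : Site (d + 1) × Site (d + 1) => ∑ κ, ∑ κ₂, n κ ux.1 * dz φ κ₂ ux.2 *
        e3OfK Lc (coDressKBmAt (toSite r) Lc (KInvStep (d := d) Lc j)) (fun κ' u' => vhSAt (toSite r) d Lc rfl κ' u') l t ux.1 ux.2 (Sum.inl κ) (Sum.inl κ₂))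
      ((stepScale d Lc j * (Lc : ℝ) ^ (d + 1))⁻¹ * ((Lc : ℝ) ^ (d + 1))⁻¹ *
        ∑' y₀ : Site (d + 1), ∑ μ : Fin (d + 1),
          (∑ κ, ∑' u : Site (d + 1), n κ u * colM (coDressKBmAt (toSite r) Lc (KInvStep (d := d) Lc j)) Lc μ y₀ κ u)
            * (dz φ μ y₀ * ∑ b ∈ box (d + 1) Lc, ∑ s ∈ Finset.range Lc, (if b μ + s + 1 < Lc then
                colH (coDressKBmAt (toSite r) Lc (KInvStep (d := d) Lc j)) Lc l t μ ((Lc : ℤ) • y₀ + toSite b + (s : ℤ) • unitVec μ) else 0))) := by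
  classical
  have hLc : 1 ≤ Lc := one_le_of_neZero Lc
  set G : MKer (d + 1) (Fib d) := coDressKBmAt (toSite r) Lc (KInvStep (d := d) Lc j) with hGdef
  set cH : ℝ := (stepScale d Lc j * (Lc : ℝ) ^ (d + 1))⁻¹ with hcH
  -- the local stencil family and its vertex
  have hSt := locStencil_vhSAt (d := d) hLc hr (δ := 1) zero_le_one
  obtain ⟨δ, C, hδ, -, hK⟩ := decays_KInvStep (d := d) (Lc := Lc) j
  obtain ⟨δG, CG, hδG, hCG, hG⟩ := decays_coDressKBmAt hLc hr (K := KInvStep (d := d) Lc j) ⟨δ, C, hδ, hK.nonneg (Sum.inl 0), hK⟩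
  have hCs0 : 0 ≤ 3 * (AveragingHessianKernels.ell (d + 1) Lc : ℝ) ^ 2 * Real.exp (4 * ((d : ℝ) + 1) * Lc * 1) := (hSt 0 0).nonneg (Sum.inl 0)
  set m : ℝ := min 1 δG with hm
  have hm0 : 0 < m := lt_min one_pos hδG
  have hSm := locStencil_mono hSt hCs0 (min_le_left 1 δG)
  set V : MKer (d + 1) (Fib d) := vertexOfK G Lc (fun κ' u' => vhSAt (toSite r) d Lc rfl κ' u') l t with hVdef
  have hV : BiLoc V ((Lc : ℤ) • t) ((Lc : ℤ) • t) _ (m / 2) := vertexFamily_vertexOfK (N := Lc) hG hCG hSm hm0 (min_le_right _ _) l t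
  -- §2 for this family
  have h2 := hasSum_prod_gaugeLeg_e3OfK hr j (S := fun κ' u' => vhSAt (toSite r) d Lc rfl κ' u') hSt one_pos l t hn hφ
  -- the opaque `n`-leg and its bound
  set ρLs : Fib d → Site (d + 1) → ℝ := fun f y => ∑ κ, ∑' u : Site (d + 1), n κ u * G ((Lc : ℤ) • u) y (Sum.inr κ) f with hρLs
  have hBn : 0 ≤ Bn := (abs_nonneg _).trans (hn 0 0)
  set T : ℝ := Real.exp (δG * ((Lc : ℝ) * (d + 1))) * Zl (d + 1) δG with hT
  have hρb : ∀ f y, |ρLs f y| ≤ ((d + 1 : ℕ) : ℝ) * (Bn * CG * T) := fun f y => by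
    simp only [hρLs]
    refine (Finset.abs_sum_le_sum_abs _ _).trans ?_
    calc ∑ κ, |∑' u : Site (d + 1), n κ u * G ((Lc : ℤ) • u) y (Sum.inr κ) f| ≤ ∑ κ : Fin (d + 1), Bn * CG * T :=
          Finset.sum_le_sum fun κ _ => (summable_weight_row (N := Lc) hG hδG (ω := n κ) (fun u => hn κ u) y (Sum.inr κ) f).2
      _ = _ := by simp only [Finset.sum_const, Finset.card_univ, Fintype.card_fin, nsmul_eq_mul]
  have hBφ : 0 ≤ Bφ := (abs_nonneg _).trans (hφ 0)
  have hgb : ∀ a w, |dz (fun x => φ (blk Lc x)) a w| ≤ 2 * Bφ := KKTFluctuationEnergy.abs_dz_le (fun x => hφ (blk Lc x))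
  -- the integrand after §2, block by block
  set Φ : Site (d + 1) × Site (d + 1) → ℝ := fun yw => ∑ f : Fib d, ∑ a : Fin (d + 1),
    ρLs f yw.1 * V yw.1 yw.2 f (Sum.inl a) * dz (fun x => φ (blk Lc x)) a yw.2 with hΦ
  have hΦeq : ∀ yw : Site (d + 1) × Site (d + 1), Φ yw = ∑ m : Fin (d + 1), ∑ a : Fin (d + 1),
      ρLs (Sum.inr m) yw.1 * V yw.1 yw.2 (Sum.inr m) (Sum.inl a) * dz (fun x => φ (blk Lc x)) a yw.2 := by
    intro yw
    simp only [hΦ]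
    rw [Fintype.sum_sum_type]
    have h0 : ∀ κ' a, V yw.1 yw.2 (Sum.inl κ') (Sum.inl a) = 0 := fun κ' a => vertexOfK_vhSAt_inl_inl G Lc (toSite r) l t yw.1 yw.2 κ' a
    simp only [h0, mul_zero, zero_mul, Finset.sum_const_zero, zero_add]
  have hΦs : Summable Φ := by
    refine summable_sum fun f _ => summable_sum fun a _ => ?_
    have hw : ∀ yw : Site (d + 1) × Site (d + 1), |ρLs f yw.1 * dz (fun x => φ (blk Lc x)) a yw.2| ≤ (((d + 1 : ℕ) : ℝ) * (Bn * CG * T)) * (2 * Bφ) :=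
      fun yw => by
        rw [abs_mul]
        exact mul_le_mul (hρb f yw.1) (hgb a yw.2) (abs_nonneg _) ((abs_nonneg _).trans (hρb f yw.1))
    exact (summable_bdd_mul (summable_prod_of_biLoc hV (half_pos hm0) f (Sum.inl a)) hw).congr fun yw => by ring
  -- fibrewise: off the coarse images the fibre vanishes
  have hF0 : ∀ y : Site (d + 1), off Lc y ≠ 0 → (∑' w : Site (d + 1), Φ (y, w)) = 0 := by
    intro y hy
    have h0 : ∀ w, Φ (y, w) = 0 := fun w => by
      rw [hΦeq]
      refine Finset.sum_eq_zero fun μ _ => Finset.sum_eq_zero fun a _ => ?_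
      rw [hVdef, vertexOfK_vhSAt_inr_inl_of_off G Lc (toSite r) l t hy w μ a, mul_zero, zero_mul]
    simp only [h0, tsum_zero]
  -- on the coarse images it is (β)'s pairing, weighted by the multiplier response of `n`
  have hFc : ∀ y₀ : Site (d + 1), (∑' w : Site (d + 1), Φ ((Lc : ℤ) • y₀, w))
      = ∑ μ : Fin (d + 1), ρLs (Sum.inr μ) ((Lc : ℤ) • y₀) *
          -(((Lc : ℝ) ^ (d + 1))⁻¹ * (dz φ μ y₀ * ∑ b ∈ box (d + 1) Lc, ∑ s ∈ Finset.range Lc, (if b μ + s + 1 < Lc then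
              colH G Lc l t μ ((Lc : ℤ) • y₀ + toSite b + (s : ℤ) • unitVec μ) else 0))) := by
    intro y₀
    -- per `μ`: summability in `w`, then pull the finite sums out
    have hVg : ∀ μ a, Summable fun w : Site (d + 1) => V ((Lc : ℤ) • y₀) w (Sum.inr μ) (Sum.inl a) * dz (fun x => φ (blk Lc x)) a w := by
      intro μ a
      have hVw : Summable fun w : Site (d + 1) => V ((Lc : ℤ) • y₀) w (Sum.inr μ) (Sum.inl a) :=
        (summable_prod_of_biLoc hV (half_pos hm0) (Sum.inr μ) (Sum.inl a)).prod_factor ((Lc : ℤ) • y₀)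
      exact (summable_bdd_mul hVw (fun w => hgb a w)).congr fun w => by ring
    have hsw : ∀ μ a, Summable fun w : Site (d + 1) =>
        ρLs (Sum.inr μ) ((Lc : ℤ) • y₀) * V ((Lc : ℤ) • y₀) w (Sum.inr μ) (Sum.inl a) * dz (fun x => φ (blk Lc x)) a w :=
      fun μ a => ((hVg μ a).mul_left (ρLs (Sum.inr μ) ((Lc : ℤ) • y₀))).congr fun w => by ring
    rw [tsum_congr (fun w => hΦeq ((Lc : ℤ) • y₀, w)), Summable.tsum_finsetSum (fun μ _ => summable_sum fun a _ => hsw μ a)]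
    refine Finset.sum_congr rfl fun μ _ => ?_
    rw [Summable.tsum_finsetSum (fun a _ => hsw μ a)]
    have e1 : (∑ a : Fin (d + 1), ∑' w : Site (d + 1),
        ρLs (Sum.inr μ) ((Lc : ℤ) • y₀) * V ((Lc : ℤ) • y₀) w (Sum.inr μ) (Sum.inl a) * dz (fun x => φ (blk Lc x)) a w)
        = ρLs (Sum.inr μ) ((Lc : ℤ) • y₀) * ∑' w : Site (d + 1), ∑ a : Fin (d + 1),
            V ((Lc : ℤ) • y₀) w (Sum.inr μ) (Sum.inl a) * dz (fun x => φ (blk Lc x)) a w := by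
      rw [Summable.tsum_finsetSum (fun a _ => hVg μ a), Finset.mul_sum]
      refine Finset.sum_congr rfl fun a _ => ?_
      rw [← tsum_mul_left]
      exact tsum_congr fun w => by ring
    rw [e1, hVdef, hGdef, tsum_sum_vertexOfK_vhSAt_mul_dz hr j l t y₀ μ hφ]
  -- assemble
  have eρ : ∀ (μ : Fin (d + 1)) (y₀ : Site (d + 1)), ρLs (Sum.inr μ) ((Lc : ℤ) • y₀) = ∑ κ, ∑' u : Site (d + 1), n κ u * colM G Lc μ y₀ κ u :=
    fun μ y₀ => rfl
  have ept : ∀ y₀ : Site (d + 1), (∑ μ : Fin (d + 1), ρLs (Sum.inr μ) ((Lc : ℤ) • y₀) *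
      -(((Lc : ℝ) ^ (d + 1))⁻¹ * (dz φ μ y₀ * ∑ b ∈ box (d + 1) Lc, ∑ s ∈ Finset.range Lc, (if b μ + s + 1 < Lc then
          colH G Lc l t μ ((Lc : ℤ) • y₀ + toSite b + (s : ℤ) • unitVec μ) else 0))))
      = -(((Lc : ℝ) ^ (d + 1))⁻¹ * ∑ μ : Fin (d + 1), (∑ κ, ∑' u : Site (d + 1), n κ u * colM G Lc μ y₀ κ u)
          * (dz φ μ y₀ * ∑ b ∈ box (d + 1) Lc, ∑ s ∈ Finset.range Lc, (if b μ + s + 1 < Lc then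
              colH G Lc l t μ ((Lc : ℤ) • y₀ + toSite b + (s : ℤ) • unitVec μ) else 0))) := by
    intro y₀
    rw [Finset.mul_sum, ← Finset.sum_neg_distrib]
    refine Finset.sum_congr rfl fun μ _ => ?_
    rw [eρ μ y₀]
    ring
  have hval : (∑' yw : Site (d + 1) × Site (d + 1), Φ yw)
      = -(((Lc : ℝ) ^ (d + 1))⁻¹ * ∑' y₀ : Site (d + 1), ∑ μ : Fin (d + 1),
          (∑ κ, ∑' u : Site (d + 1), n κ u * colM G Lc μ y₀ κ u)
            * (dz φ μ y₀ * ∑ b ∈ box (d + 1) Lc, ∑ s ∈ Finset.range Lc, (if b μ + s + 1 < Lc then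
                colH G Lc l t μ ((Lc : ℤ) • y₀ + toSite b + (s : ℤ) • unitVec μ) else 0))) := by
    calc (∑' yw : Site (d + 1) × Site (d + 1), Φ yw) = ∑' y : Site (d + 1), ∑' w : Site (d + 1), Φ (y, w) := hΦs.tsum_prod
      _ = ∑' y₀ : Site (d + 1), ∑' w : Site (d + 1), Φ ((Lc : ℤ) • y₀, w) :=
          tsum_eq_tsum_zsmul_of_off hLc (F := fun y => ∑' w : Site (d + 1), Φ (y, w)) hF0
      _ = _ := by rw [tsum_congr hFc, tsum_congr ept, tsum_neg, tsum_mul_left]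
  have h3 : HasSum (fun ux : Site (d + 1) × Site (d + 1) => ∑ κ, ∑ κ₂, n κ ux.1 * dz φ κ₂ ux.2 *
      e3OfK Lc G (fun κ' u' => vhSAt (toSite r) d Lc rfl κ' u') l t ux.1 ux.2 (Sum.inl κ) (Sum.inl κ₂)) (-(cH * ∑' yw, Φ yw)) := by
    simpa only [hΦ, hρLs] using h2
  rw [hval] at h3
  convert h3 using 1
  ring

end Step

end Summit.QuantumFields.BalabanUV.Beta.GAN24.BorderSectorSourcePairingSucc

end
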